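import Literature.AlgebraicGeometry.Motives.ProjectiveNoetherNormalization
import Literature.AlgebraicGeometry.Motives.AbelianVarietyDegree
import Literature.AlgebraicGeometry.Motives.VarietiesDimensionProofs
import Literature.AlgebraicGeometry.Motives.VarietiesGeometricallyIntegralProofs
import Literature.AlgebraicGeometry.Motives.VarietiesProperProofs
import HarnessLib

/-!
# Projective Noether normalisation of a smooth projective variety: a finite surjective `V → ℙᵈ`

For a smooth projective variety `V` of dimension `d` over a field `k` there is a finite surjective
`k`-morphism `ψ : V → ℙᵈ_k` (`IsSmoothProjective.exists_isFinite_surjective_hom`; Görtz–Wedhorn I,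
Thm. 13.89; Hartshorne I Thm. 7.2 ff. / II Ex. 4.1). Assembly of tree results: a closed immersion
`r : V ↪ ℙⁿ` gives generating sections `r^* xⱼ` with affine non-vanishing loci `r⁻¹D₊(xⱼ)`
(`GeneratingSections.ofHom`), whose hyperplane divisor is ample (`GeneratingSections.isAmple_divisor`),
and an ample divisor on an integral proper `k`-scheme yields a finite surjective morphism to
`ℙ^{dim V}` (`CartierDivisor.IsAmple.exists_finite_surjective_linEquiv`, forms of high degree);
finally `dim V = d` (`schemeDim_eq_holds`).

## References
* [GortzWedhorn2020] U. Görtz, T. Wedhorn, Algebraic Geometry I, 2nd ed. 2020, Thm. 13.89, Prop. 13.47.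
* [Hartshorne1977] R. Hartshorne, Algebraic Geometry, II Ex. 4.1, II Thm. 7.1.

#harness_tags algebraic_geometry.finite_morphisms, algebraic_geometry.projective_varieties
-/

noncomputable section

open CategoryTheory AlgebraicGeometry

universe u

namespace Literature.AlgebraicGeometry.Motives

attribute [local instance] MvPolynomial.gradedAlgebra

variable {k : Type u} [Field k] {d : ℕ} {V : SchemeOver k}

/-- **A smooth projective variety of dimension `d` admits a finite surjective `k`-morphism onto
`ℙᵈ_k`** (projective Noether normalisation). [cite: GortzWedhorn2020, Thm. 13.89] -/
theorem IsSmoothProjective.exists_isFinite_surjective_hom (hV : IsSmoothProjective d V) :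
    ∃ ψ : V ⟶ projectiveSpace d k, IsFinite ψ.left ∧ Surjective ψ.left := by
  classical
  haveI : IsIntegral V.left := IsSmoothProjective.isIntegral_holds hV
  haveI : IsProper (V.left ↘ Spec (.of k)) := IsSmoothProjective.isProper_holds hV
  haveI : CompactSpace V.left := compactSpace_of_isProper k V.left
  haveI : QuasiSeparatedSpace V.left := quasiSeparatedSpace_of_quasiSeparated (V.left ↘ Spec (.of k))
  obtain ⟨n, i, hi⟩ := hV.isProjectiveOver
  let r : V.left ⟶ Proj (Segre.grading (Fin (n + 1)) k) := i.left
  haveI : IsClosedImmersion r := hi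
  let G := GeneratingSections.ofHom r
  obtain ⟨j₀, hj₀⟩ := G.exists_mem_U (genericPoint V.left)
  have hH : (G.divisor j₀ hj₀).IsAmple :=
    G.isAmple_divisor j₀ hj₀ (GeneratingSections.isAffineOpen_ofHom_U r)
  obtain ⟨n₀, hn₀⟩ := hH.exists_finite_surjective_linEquiv (K := k)
  obtain ⟨-, ψ, hψfin, hψsurj, hψover, -⟩ := hn₀ 2 one_lt_two (n₀ + 1) (Nat.le_succ _) (Nat.succ_pos _)
  have hdim : schemeDim V.left = d := schemeDim_eq_holds hV
  subst hdim
  exact ⟨Over.homMk ψ hψover, hψfin, hψsurj⟩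

end Literature.AlgebraicGeometry.Motives
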